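import Literature.MathematicalPhysics.QuantumLattice.HubbardSliceSymbolSmoothMomentum
import HarnessLib

/-!
# The ultraviolet (scale-`0`) symbol `w_Λ·βL²/(-iω+e)` as a smooth function of the frequency and of the band: envelopes
# `‖Ψ‖ ≤ c/m(ω)`, `‖Ψ′‖ ≤ (2B₁+1)c/m(ω)²`, `‖Ψ″‖ ≤ (4B₂+6B₁+2)c/m(ω)³`, `m(ω) = max(|ω|, Λ/2)`

Topic `MathematicalPhysics/QuantumLattice`; the ultraviolet companion of `HubbardSliceSymbolSmooth(Momentum)` (cell gate-hubbard-kl; there: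
the SLICE symbol `(w_Λ - w_Λ′)·R`, compactly supported in the frequency; here: the symbol of the covariance ABOVE scale `Λ`,
`C_{>Λ} = w_Λ · C`, Salmhofer (4.70), whose weight `w_Λ(ω,e) = χ₂((ω²+e²)/Λ²)` equals `1` at all large frequencies — the decay in `ω`
comes from the resolvent `R = c/(-iω+e)` alone).  Input of the decay constant (row/column `ℓ¹` norm) of the scale-`0` covariance of the
K3 engine on the `4M` time grid (`stub_engine_scale0`, hypothesis `hrow/hcol` of `GrassmannEffectiveActionBoundDB.sum_norm_kernel_effAction_le_of_gramBounded`).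

With `W(ω) = χ₂((ω²+e²)/Λ²)` (`|W| ≤ 1`, `|W′| ≤ 2B₁/Λ`, `|W″| ≤ (4B₂+2B₁)/Λ²`, `W′, W″` supported in the transition shell
`Λ²/4 ≤ ω²+e² ≤ Λ²`, `W = 0` below it) and `R = c/(-iω+e)` (`resolventFn c 0`, `‖-iω+e‖ = √(ω²+e²) ≥ m(ω) := max(|ω|, Λ/2)` wherever
`W ≠ 0`, and `Λ ≥ m(ω)` on the transition shell):

* `uvWeightFn`, `uvWeightFnD1`, `uvWeightFnD2`, `hasDerivAt_uvWeightFn`, `hasDerivAt_uvWeightFnD1`, the bounds and the vanishing lemmas;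
* `uvSymbolFn c Λ e ω = W·R` (frequency direction) with `…D1`, `…D2`, `hasDerivAt_uvSymbolFn`, `hasDerivAt_uvSymbolFnD1`,
  **`norm_uvSymbolFn_le`** (`≤ c/m`), **`norm_uvSymbolFnD2_le`** (`≤ (4B₂+6B₁+2)c/m³`);
* `uvSymbolFnXi c Λ ω e = W·R` (band direction) with `…D1`, `…D2`, `hasDerivAt_…`, **`norm_uvSymbolFnXiD1_le`** (`≤ (2B₁+1)c/m²`),
  **`norm_uvSymbolFnXiD2_le`** (`≤ (4B₂+6B₁+2)c/m³`), `uvSymbolFn_eq_uvSymbolFnXi`;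
* the composition with a `C²` path `e(t)` in the band variable (a lattice line of a dispersion relation with bounded first and second
  derivatives): `uvPathFn`, `…D1`, `…D2`, `hasDerivAt_uvPathFn`, `hasDerivAt_uvPathFnD1`, **`norm_uvPathFnD2_le`**
  (`≤ (D²(4B₂+6B₁+2)·2/Λ + D(2B₁+1))·c/m(ω)²`).

Everything is proved; the functions are the only definitions; no named facts.

## Sources

M. Salmhofer, *Renormalization* (1999), §4.2.5 (4.70)–(4.71) (`Salmhofer1999`); G. Benfatto, A. Giuliani, V. Mastropietro,
Ann. Henri Poincaré 7 (2006) 809–898, §2.1 (2.3), (2.36aa), App. A1 (the ultraviolet integration) (`BenfattoGiulianiMastropietro2006`);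
W. de Siqueira Pedra, M. Salmhofer, Comm. Math. Phys. 282 (2008) 797–818, §4 Cor. 4.4 (decay constants of positive-temperature covariances)
(`PedraSalmhofer2008`).
-/

noncomputable section

namespace Literature.MathematicalPhysics.QuantumLattice

open Literature.Probability.LatticeModels Set Complex

/-! ### The ultraviolet weight as a function of the frequency -/

/-- The **continuum ultraviolet weight** `W(ω) = χ₂((ω²+e²)/Λ²)` (Salmhofer (4.70): the weight of the fields ABOVE scale `Λ`).
[cite: Salmhofer1999, §4.2.5 (4.70)] -/
def uvWeightFn (Λ e ω : ℝ) : ℝ := salmhoferCutoff ((ω ^ 2 + e ^ 2) / Λ ^ 2)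

/-- Its first `ω`-derivative `χ₂′(q)·2ω/Λ²`. [cite: Salmhofer1999, §4.2.5 (4.70)] -/
def uvWeightFnD1 (Λ e ω : ℝ) : ℝ := deriv salmhoferCutoff ((ω ^ 2 + e ^ 2) / Λ ^ 2) * (2 * ω / Λ ^ 2)

/-- Its second `ω`-derivative `χ₂″(q)(2ω/Λ²)² + χ₂′(q)·2/Λ²`. [cite: Salmhofer1999, §4.2.5 (4.70)] -/
def uvWeightFnD2 (Λ e ω : ℝ) : ℝ :=
  deriv (deriv salmhoferCutoff) ((ω ^ 2 + e ^ 2) / Λ ^ 2) * (2 * ω / Λ ^ 2) * (2 * ω / Λ ^ 2) +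
    deriv salmhoferCutoff ((ω ^ 2 + e ^ 2) / Λ ^ 2) * (2 / Λ ^ 2)

/-- `W′ = uvWeightFnD1`. [cite: Salmhofer1999, §4.2.5 (4.70)] -/
theorem hasDerivAt_uvWeightFn (Λ e ω : ℝ) : HasDerivAt (uvWeightFn Λ e) (uvWeightFnD1 Λ e ω) ω := by
  unfold uvWeightFn uvWeightFnD1
  exact (hasDerivAt_salmhoferCutoff _).comp ω (hasDerivAt_sqArg Λ e ω)

/-- `W″ = uvWeightFnD2`. [cite: Salmhofer1999, §4.2.5 (4.70)] -/
theorem hasDerivAt_uvWeightFnD1 (Λ e ω : ℝ) : HasDerivAt (uvWeightFnD1 Λ e) (uvWeightFnD2 Λ e ω) ω := by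
  unfold uvWeightFnD1 uvWeightFnD2
  have hlin : HasDerivAt (fun t : ℝ => 2 * t / Λ ^ 2) (2 / Λ ^ 2) ω := by
    simpa using ((hasDerivAt_id ω).const_mul 2).div_const (Λ ^ 2)
  exact ((hasDerivAt_deriv_salmhoferCutoff _).comp ω (hasDerivAt_sqArg Λ e ω)).mul hlin

/-- `0 ≤ W ≤ 1`. [cite: Salmhofer1999, §4.2.5 (4.71)] -/
theorem uvWeightFn_mem_Icc (Λ e ω : ℝ) : uvWeightFn Λ e ω ∈ Icc (0 : ℝ) 1 := salmhoferCutoff_mem_Icc _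

/-- `|W| ≤ 1`. [cite: Salmhofer1999, §4.2.5 (4.71)] -/
theorem abs_uvWeightFn_le_one (Λ e ω : ℝ) : |uvWeightFn Λ e ω| ≤ 1 := by
  have h := uvWeightFn_mem_Icc Λ e ω
  exact abs_le.2 ⟨by linarith [h.1], h.2⟩

/-- `|W′| ≤ 2B₁/Λ`. [cite: BenfattoGiulianiMastropietro2006, (2.36aa)] -/
theorem abs_uvWeightFnD1_le {B₁ : ℝ} (hB₁ : ∀ x, |deriv salmhoferCutoff x| ≤ B₁) {Λ : ℝ} (hΛ : 0 < Λ) (e ω : ℝ) :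
    |uvWeightFnD1 Λ e ω| ≤ 2 * B₁ / Λ :=
  abs_deriv_term_le hB₁ hΛ e ω

/-- `|W″| ≤ (4B₂ + 2B₁)/Λ²`. [cite: BenfattoGiulianiMastropietro2006, (2.36aa)] -/
theorem abs_uvWeightFnD2_le {B₁ B₂ : ℝ} (hB₁ : ∀ x, |deriv salmhoferCutoff x| ≤ B₁)
    (hB₂ : ∀ x, |deriv (deriv salmhoferCutoff) x| ≤ B₂) {Λ : ℝ} (hΛ : 0 < Λ) (e ω : ℝ) :
    |uvWeightFnD2 Λ e ω| ≤ (4 * B₂ + 2 * B₁) / Λ ^ 2 :=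
  abs_deriv2_term_le hB₁ hB₂ hΛ e ω

/-- **Below the shell everything vanishes**: `ω²+e² < Λ²/4 ⟹ W = W′ = W″ = 0`. [cite: Salmhofer1999, §4.2.5 (4.71)] -/
theorem uvWeightFn_eq_zero_of_lt {Λ : ℝ} (hΛ : 0 < Λ) {e ω : ℝ} (h : ω ^ 2 + e ^ 2 < Λ ^ 2 / 4) :
    uvWeightFn Λ e ω = 0 ∧ uvWeightFnD1 Λ e ω = 0 ∧ uvWeightFnD2 Λ e ω = 0 := by
  have h1 : (ω ^ 2 + e ^ 2) / Λ ^ 2 < 1 / 4 := by rw [div_lt_iff₀ (by positivity)]; linarith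
  unfold uvWeightFn uvWeightFnD1 uvWeightFnD2
  simp [salmhoferCutoff_of_le h1.le, deriv_salmhoferCutoff_eq_zero_of_lt h1, deriv_deriv_salmhoferCutoff_eq_zero_of_lt h1]

/-- **Above the shell the weight is one and its derivatives vanish**: `Λ² < ω²+e² ⟹ W = 1, W′ = W″ = 0`.
[cite: Salmhofer1999, §4.2.5 (4.71)] -/
theorem uvWeightFn_eq_one_of_gt {Λ : ℝ} (hΛ : 0 < Λ) {e ω : ℝ} (h : Λ ^ 2 < ω ^ 2 + e ^ 2) :
    uvWeightFn Λ e ω = 1 ∧ uvWeightFnD1 Λ e ω = 0 ∧ uvWeightFnD2 Λ e ω = 0 := by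
  have h1 : 1 < (ω ^ 2 + e ^ 2) / Λ ^ 2 := by rw [lt_div_iff₀ (by positivity)]; linarith
  unfold uvWeightFn uvWeightFnD1 uvWeightFnD2
  simp [salmhoferCutoff_of_ge h1.le, deriv_salmhoferCutoff_eq_zero_of_gt h1, deriv_deriv_salmhoferCutoff_eq_zero_of_gt h1]

/-! ### The denominator `-iω + e` (the case `θ = 0` of `HubbardSliceSymbolSmooth`) and the envelope `m(ω) = max(|ω|, Λ/2)` -/

/-- `‖-iω+e‖² = ω² + e²`. [cite: BenfattoGiulianiMastropietro2006, §2.1 (2.3)] -/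
theorem norm_sq_uvDen (e ω : ℝ) : ‖-I * ((ω + 0 : ℝ) : ℂ) + (e : ℂ)‖ ^ 2 = ω ^ 2 + e ^ 2 := by
  rw [norm_sq_shiftDen]; ring

/-- `‖-iω+e‖ ≥ |ω|`. [cite: BenfattoGiulianiMastropietro2006, §2.1 (2.3)] -/
theorem abs_le_norm_uvDen (e ω : ℝ) : |ω| ≤ ‖-I * ((ω + 0 : ℝ) : ℂ) + (e : ℂ)‖ :=
  abs_le_of_sq_le_sq' (by rw [norm_sq_uvDen]; nlinarith [sq_nonneg e, sq_abs ω]) (norm_nonneg _) |>.2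

/-- On the closed shell `Λ²/4 ≤ ω²+e²`: `‖-iω+e‖ ≥ max(|ω|, Λ/2)`. [cite: BenfattoGiulianiMastropietro2006, §2.1 (2.3)] -/
theorem max_le_norm_uvDen {Λ e ω : ℝ} (hΛ : 0 < Λ) (h : Λ ^ 2 / 4 ≤ ω ^ 2 + e ^ 2) :
    max |ω| (Λ / 2) ≤ ‖-I * ((ω + 0 : ℝ) : ℂ) + (e : ℂ)‖ := by
  refine max_le (abs_le_norm_uvDen e ω) ?_
  have hΛ2 : 0 ≤ Λ / 2 := by positivity
  exact (abs_le_of_sq_le_sq' (by rw [norm_sq_uvDen]; nlinarith [hΛ2]) (norm_nonneg _)).2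

/-- The envelope is positive: `0 < max(|ω|, Λ/2)`. [cite: BenfattoGiulianiMastropietro2006, §2.1 (2.3)] -/
theorem uvEnv_pos {Λ : ℝ} (hΛ : 0 < Λ) (ω : ℝ) : 0 < max |ω| (Λ / 2) := lt_max_of_lt_right (by positivity)

/-- On the transition shell `ω²+e² ≤ Λ²` the envelope is at most `Λ`: `max(|ω|, Λ/2) ≤ Λ`. [cite: BenfattoGiulianiMastropietro2006, §2.1 (2.3)] -/
theorem uvEnv_le_of_le {Λ e ω : ℝ} (hΛ : 0 < Λ) (h : ω ^ 2 + e ^ 2 ≤ Λ ^ 2) : max |ω| (Λ / 2) ≤ Λ := by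
  refine max_le ?_ (by linarith)
  have hω2 : |ω| ^ 2 ≤ Λ ^ 2 := by rw [sq_abs]; nlinarith [sq_nonneg e]
  exact (abs_le_of_sq_le_sq' hω2 hΛ.le).2

/-! ### The ultraviolet symbol as a function of the frequency: `Ψ = W · R` -/

/-- The **continuum ultraviolet symbol** `Ψ_e(ω) = W(ω)·c/(-iω+e)` (`c = βL²`). [cite: Salmhofer1999, §4.2.5 (4.70)] -/
def uvSymbolFn (c Λ e ω : ℝ) : ℂ := (uvWeightFn Λ e ω : ℂ) * resolventFn c 0 e ω

/-- `Ψ′ = W′R + WR′`. [cite: Salmhofer1999, §4.2.5 (4.70)] -/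
def uvSymbolFnD1 (c Λ e ω : ℝ) : ℂ :=
  (uvWeightFnD1 Λ e ω : ℂ) * resolventFn c 0 e ω + (uvWeightFn Λ e ω : ℂ) * resolventFnD1 c 0 e ω

/-- `Ψ″ = W″R + 2W′R′ + WR″`. [cite: Salmhofer1999, §4.2.5 (4.70)] -/
def uvSymbolFnD2 (c Λ e ω : ℝ) : ℂ :=
  (uvWeightFnD2 Λ e ω : ℂ) * resolventFn c 0 e ω + 2 * ((uvWeightFnD1 Λ e ω : ℂ) * resolventFnD1 c 0 e ω) +
    (uvWeightFn Λ e ω : ℂ) * resolventFnD2 c 0 e ω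

section Freq

variable {c Λ e : ℝ}

/-- Off the pole or identically zero: `ω² + e² > Λ²/5` forces `-iω+e ≠ 0`. [cite: BenfattoGiulianiMastropietro2006, (2.36aa)] -/
theorem uvDen_ne_zero_of_gt (hΛ : 0 < Λ) {ω : ℝ} (h : Λ ^ 2 / 5 < ω ^ 2 + e ^ 2) :
    (-I * ((ω + 0 : ℝ) : ℂ) + (e : ℂ)) ≠ 0 :=
  shiftDen_ne_zero_of_gt (θ := 0) (Λ := Λ) (ξ := e) (by rw [abs_zero]; positivity) h

/-- **`Ψ` is differentiable everywhere with derivative `Ψ′`.** [cite: BenfattoGiulianiMastropietro2006, (2.36aa)] -/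
theorem hasDerivAt_uvSymbolFn (hΛ : 0 < Λ) (ω : ℝ) : HasDerivAt (uvSymbolFn c Λ e) (uvSymbolFnD1 c Λ e ω) ω := by
  by_cases h : Λ ^ 2 / 5 < ω ^ 2 + e ^ 2
  · unfold uvSymbolFn uvSymbolFnD1
    exact (hasDerivAt_uvWeightFn Λ e ω).ofReal_comp.mul (hasDerivAt_resolventFn (uvDen_ne_zero_of_gt hΛ h))
  · have hlt : ω ^ 2 + e ^ 2 < Λ ^ 2 / 4 := by linarith [not_lt.1 h, pow_pos hΛ 2]
    have hopen : ∀ᶠ t in nhds ω, t ^ 2 + e ^ 2 < Λ ^ 2 / 4 :=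
      (continuous_pow 2 |>.add continuous_const).continuousAt.eventually_lt continuousAt_const hlt
    have hev : uvSymbolFn c Λ e =ᶠ[nhds ω] fun _ => (0 : ℂ) := by
      filter_upwards [hopen] with t ht
      rw [uvSymbolFn, (uvWeightFn_eq_zero_of_lt hΛ ht).1, Complex.ofReal_zero, zero_mul]
    have hD1 : uvSymbolFnD1 c Λ e ω = 0 := by
      obtain ⟨h0, h1, -⟩ := uvWeightFn_eq_zero_of_lt hΛ hlt
      rw [uvSymbolFnD1, h0, h1, Complex.ofReal_zero, zero_mul, zero_mul, add_zero]
    rw [hD1]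
    exact (hasDerivAt_const ω (0 : ℂ)).congr_of_eventuallyEq hev

/-- **`Ψ′` is differentiable everywhere with derivative `Ψ″`.** [cite: BenfattoGiulianiMastropietro2006, (2.36aa)] -/
theorem hasDerivAt_uvSymbolFnD1 (hΛ : 0 < Λ) (ω : ℝ) : HasDerivAt (uvSymbolFnD1 c Λ e) (uvSymbolFnD2 c Λ e ω) ω := by
  by_cases h : Λ ^ 2 / 5 < ω ^ 2 + e ^ 2
  · have hne := uvDen_ne_zero_of_gt hΛ h
    unfold uvSymbolFnD1 uvSymbolFnD2
    have hA := (hasDerivAt_uvWeightFnD1 Λ e ω).ofReal_comp.mul (hasDerivAt_resolventFn (c := c) hne)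
    have hB := (hasDerivAt_uvWeightFn Λ e ω).ofReal_comp.mul (hasDerivAt_resolventFnD1 (c := c) hne)
    refine (hA.add hB).congr_deriv ?_
    ring
  · have hlt : ω ^ 2 + e ^ 2 < Λ ^ 2 / 4 := by linarith [not_lt.1 h, pow_pos hΛ 2]
    have hopen : ∀ᶠ t in nhds ω, t ^ 2 + e ^ 2 < Λ ^ 2 / 4 :=
      (continuous_pow 2 |>.add continuous_const).continuousAt.eventually_lt continuousAt_const hlt
    have hev : uvSymbolFnD1 c Λ e =ᶠ[nhds ω] fun _ => (0 : ℂ) := by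
      filter_upwards [hopen] with t ht
      obtain ⟨h0, h1, -⟩ := uvWeightFn_eq_zero_of_lt hΛ ht
      rw [uvSymbolFnD1, h0, h1, Complex.ofReal_zero, zero_mul, zero_mul, add_zero]
    have hD2 : uvSymbolFnD2 c Λ e ω = 0 := by
      obtain ⟨h0, h1, h2⟩ := uvWeightFn_eq_zero_of_lt hΛ hlt
      rw [uvSymbolFnD2, h0, h1, h2, Complex.ofReal_zero]
      ring
    rw [hD2]
    exact (hasDerivAt_const ω (0 : ℂ)).congr_of_eventuallyEq hev

/-- **`‖Ψ(ω)‖ ≤ c/max(|ω|, Λ/2)`** (`c ≥ 0`, `0 < Λ`): the ultraviolet symbol decays like the bare propagator and is bounded by `2c/Λ`.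
[cite: BenfattoGiulianiMastropietro2006, §2.1 (2.3)] -/
theorem norm_uvSymbolFn_le (hΛ : 0 < Λ) (hc : 0 ≤ c) (ω : ℝ) : ‖uvSymbolFn c Λ e ω‖ ≤ c / max |ω| (Λ / 2) := by
  by_cases hlt : ω ^ 2 + e ^ 2 < Λ ^ 2 / 4
  · rw [uvSymbolFn, (uvWeightFn_eq_zero_of_lt hΛ hlt).1, Complex.ofReal_zero, zero_mul, norm_zero]
    exact div_nonneg hc (uvEnv_pos hΛ ω).le
  · have hden := max_le_norm_uvDen hΛ (not_lt.1 hlt)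
    have hm := uvEnv_pos hΛ ω
    rw [uvSymbolFn, norm_mul, Complex.norm_real, Real.norm_eq_abs, norm_resolventFn hc]
    calc |uvWeightFn Λ e ω| * (c / ‖-I * ((ω + 0 : ℝ) : ℂ) + (e : ℂ)‖) ≤ 1 * (c / max |ω| (Λ / 2)) :=
          mul_le_mul (abs_uvWeightFn_le_one Λ e ω) (div_le_div_of_nonneg_left hc hm hden) (by positivity) zero_le_one
      _ = c / max |ω| (Λ / 2) := one_mul _

/-- **`‖Ψ″(ω)‖ ≤ (4B₂ + 6B₁ + 2)·c/max(|ω|, Λ/2)³`** everywhere (`c ≥ 0`, `0 < Λ`; `B₁, B₂` global bounds of `χ₂′, χ₂″`): on the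
transition shell the weight derivatives cost `Λ⁻¹, Λ⁻²` against `Λ ≥ max(|ω|, Λ/2)`, above it only `R″ = -2c/(-iω+e)³` survives.
[cite: BenfattoGiulianiMastropietro2006, (2.36aa)] -/
theorem norm_uvSymbolFnD2_le (hΛ : 0 < Λ) (hc : 0 ≤ c) {B₁ B₂ : ℝ} (hB₁ : ∀ x, |deriv salmhoferCutoff x| ≤ B₁)
    (hB₂ : ∀ x, |deriv (deriv salmhoferCutoff) x| ≤ B₂) (ω : ℝ) :
    ‖uvSymbolFnD2 c Λ e ω‖ ≤ (4 * B₂ + 6 * B₁ + 2) * c / max |ω| (Λ / 2) ^ 3 := by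
  have hB10 : 0 ≤ B₁ := (abs_nonneg _).trans (hB₁ 0)
  have hB20 : 0 ≤ B₂ := (abs_nonneg _).trans (hB₂ 0)
  have hm := uvEnv_pos hΛ ω
  set m := max |ω| (Λ / 2) with hmdef
  by_cases hlt : ω ^ 2 + e ^ 2 < Λ ^ 2 / 4
  · obtain ⟨h0, h1, h2⟩ := uvWeightFn_eq_zero_of_lt hΛ hlt
    rw [uvSymbolFnD2, h0, h1, h2, Complex.ofReal_zero]
    simp only [zero_mul, mul_zero, add_zero, norm_zero]
    positivity
  · have hden := max_le_norm_uvDen hΛ (not_lt.1 hlt)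
    rw [← hmdef] at hden
    set a := ‖-I * ((ω + 0 : ℝ) : ℂ) + (e : ℂ)‖ with ha
    have ha0 : 0 < a := lt_of_lt_of_le hm hden
    -- resolvent bounds against the envelope
    have hR : ‖resolventFn c 0 e ω‖ ≤ c / m := by
      rw [norm_resolventFn hc]; exact div_le_div_of_nonneg_left hc hm hden
    have hR1 : ‖resolventFnD1 c 0 e ω‖ ≤ c / m ^ 2 := by
      rw [norm_resolventFnD1 hc]; exact div_le_div_of_nonneg_left hc (by positivity) (pow_le_pow_left₀ hm.le hden 2)
    have hR2 : ‖resolventFnD2 c 0 e ω‖ ≤ 2 * c / m ^ 3 := by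
      rw [norm_resolventFnD2 hc]; exact div_le_div_of_nonneg_left (by positivity) (by positivity) (pow_le_pow_left₀ hm.le hden 3)
    have hW : ‖(uvWeightFn Λ e ω : ℂ)‖ ≤ 1 := by
      rw [Complex.norm_real, Real.norm_eq_abs]; exact abs_uvWeightFn_le_one Λ e ω
    by_cases hgt : Λ ^ 2 < ω ^ 2 + e ^ 2
    · -- above the shell: `Ψ″ = R″`
      obtain ⟨h0, h1, h2⟩ := uvWeightFn_eq_one_of_gt hΛ hgt
      rw [uvSymbolFnD2, h0, h1, h2, Complex.ofReal_zero, Complex.ofReal_one]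
      simp only [zero_mul, mul_zero, zero_add, one_mul]
      refine hR2.trans ?_
      rw [div_le_div_iff_of_pos_right (by positivity)]
      nlinarith
    · -- transition shell: `m ≤ Λ`
      have hmΛ : m ≤ Λ := uvEnv_le_of_le hΛ (not_lt.1 hgt)
      have hW1 : ‖(uvWeightFnD1 Λ e ω : ℂ)‖ ≤ 2 * B₁ / m := by
        rw [Complex.norm_real, Real.norm_eq_abs]
        exact (abs_uvWeightFnD1_le hB₁ hΛ e ω).trans (div_le_div_of_nonneg_left (by positivity) hm hmΛ)
      have hW2 : ‖(uvWeightFnD2 Λ e ω : ℂ)‖ ≤ (4 * B₂ + 2 * B₁) / m ^ 2 := by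
        rw [Complex.norm_real, Real.norm_eq_abs]
        exact (abs_uvWeightFnD2_le hB₁ hB₂ hΛ e ω).trans
          (div_le_div_of_nonneg_left (by positivity) (by positivity) (pow_le_pow_left₀ hm.le hmΛ 2))
      rw [uvSymbolFnD2]
      calc _ ≤ ‖(uvWeightFnD2 Λ e ω : ℂ) * resolventFn c 0 e ω‖ + ‖2 * ((uvWeightFnD1 Λ e ω : ℂ) * resolventFnD1 c 0 e ω)‖ +
            ‖(uvWeightFn Λ e ω : ℂ) * resolventFnD2 c 0 e ω‖ := norm_add₃_le
        _ ≤ (4 * B₂ + 2 * B₁) / m ^ 2 * (c / m) + 2 * (2 * B₁ / m * (c / m ^ 2)) + 1 * (2 * c / m ^ 3) := by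
            refine add_le_add (add_le_add ?_ ?_) ?_
            · rw [norm_mul]; exact mul_le_mul hW2 hR (norm_nonneg _) (by positivity)
            · rw [norm_mul, norm_mul, Complex.norm_ofNat]
              exact mul_le_mul_of_nonneg_left (mul_le_mul hW1 hR1 (norm_nonneg _) (by positivity)) (by norm_num)
            · rw [norm_mul]; exact mul_le_mul hW hR2 (norm_nonneg _) zero_le_one
        _ = (4 * B₂ + 6 * B₁ + 2) * c / m ^ 3 := by field_simp; ring

end Freq

/-! ### The ultraviolet symbol as a function of the band: `Ψ̂_ω(e) = W(e)·c/(-iω+e)` -/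

/-- `Ψ̂_ω(e) = W(e) R(e)` with `W(e) = uvWeightFn Λ ω e` (the weight is symmetric in `ω, e`). [cite: Salmhofer1999, §4.2.5 (4.70)] -/
def uvSymbolFnXi (c Λ ω e : ℝ) : ℂ := (uvWeightFn Λ ω e : ℂ) * resolventFnXi c 0 ω e

/-- `Ψ̂′ = W′R + WR′`. [cite: Salmhofer1999, §4.2.5 (4.70)] -/
def uvSymbolFnXiD1 (c Λ ω e : ℝ) : ℂ :=
  (uvWeightFnD1 Λ ω e : ℂ) * resolventFnXi c 0 ω e + (uvWeightFn Λ ω e : ℂ) * resolventFnXiD1 c 0 ω e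

/-- `Ψ̂″ = W″R + 2W′R′ + WR″`. [cite: Salmhofer1999, §4.2.5 (4.70)] -/
def uvSymbolFnXiD2 (c Λ ω e : ℝ) : ℂ :=
  (uvWeightFnD2 Λ ω e : ℂ) * resolventFnXi c 0 ω e + 2 * ((uvWeightFnD1 Λ ω e : ℂ) * resolventFnXiD1 c 0 ω e) +
    (uvWeightFn Λ ω e : ℂ) * resolventFnXiD2 c 0 ω e

/-- The two parametrisations agree: `Ψ_e(ω) = Ψ̂_ω(e)`. [cite: Salmhofer1999, §4.2.5 (4.70)] -/
theorem uvSymbolFn_eq_uvSymbolFnXi (c Λ e ω : ℝ) : uvSymbolFn c Λ e ω = uvSymbolFnXi c Λ ω e := by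
  simp only [uvSymbolFn, uvSymbolFnXi, uvWeightFn, resolventFn, resolventFnXi, add_comm (ω ^ 2) (e ^ 2)]

section Xi

variable {c Λ ω : ℝ}

/-- Off the pole or identically zero, band version. [cite: BenfattoGiulianiMastropietro2006, (2.36aa)] -/
theorem uvDen_ne_zero_of_gt_xi (hΛ : 0 < Λ) {e : ℝ} (h : Λ ^ 2 / 5 < e ^ 2 + ω ^ 2) :
    (-I * ((ω + 0 : ℝ) : ℂ) + (e : ℂ)) ≠ 0 :=
  shiftDen_ne_zero_of_gt_xi (θ := 0) (Λ := Λ) (ω := ω) (by rw [abs_zero]; positivity) h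

/-- **`Ψ̂` is differentiable in the band everywhere.** [cite: BenfattoGiulianiMastropietro2006, (2.36aa)] -/
theorem hasDerivAt_uvSymbolFnXi (hΛ : 0 < Λ) (e : ℝ) : HasDerivAt (uvSymbolFnXi c Λ ω) (uvSymbolFnXiD1 c Λ ω e) e := by
  by_cases h : Λ ^ 2 / 5 < e ^ 2 + ω ^ 2
  · unfold uvSymbolFnXi uvSymbolFnXiD1
    exact (hasDerivAt_uvWeightFn Λ ω e).ofReal_comp.mul (hasDerivAt_resolventFnXi (uvDen_ne_zero_of_gt_xi hΛ h))
  · have hlt : e ^ 2 + ω ^ 2 < Λ ^ 2 / 4 := by linarith [not_lt.1 h, pow_pos hΛ 2]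
    have hopen : ∀ᶠ t in nhds e, t ^ 2 + ω ^ 2 < Λ ^ 2 / 4 :=
      (continuous_pow 2 |>.add continuous_const).continuousAt.eventually_lt continuousAt_const hlt
    have hev : uvSymbolFnXi c Λ ω =ᶠ[nhds e] fun _ => (0 : ℂ) := by
      filter_upwards [hopen] with t ht
      rw [uvSymbolFnXi, (uvWeightFn_eq_zero_of_lt hΛ ht).1, Complex.ofReal_zero, zero_mul]
    have hD1 : uvSymbolFnXiD1 c Λ ω e = 0 := by
      obtain ⟨h0, h1, -⟩ := uvWeightFn_eq_zero_of_lt hΛ (e := ω) (ω := e) hlt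
      rw [uvSymbolFnXiD1, h0, h1, Complex.ofReal_zero, zero_mul, zero_mul, add_zero]
    rw [hD1]
    exact (hasDerivAt_const e (0 : ℂ)).congr_of_eventuallyEq hev

/-- **`Ψ̂′` is differentiable in the band everywhere.** [cite: BenfattoGiulianiMastropietro2006, (2.36aa)] -/
theorem hasDerivAt_uvSymbolFnXiD1 (hΛ : 0 < Λ) (e : ℝ) : HasDerivAt (uvSymbolFnXiD1 c Λ ω) (uvSymbolFnXiD2 c Λ ω e) e := by
  by_cases h : Λ ^ 2 / 5 < e ^ 2 + ω ^ 2
  · have hne := uvDen_ne_zero_of_gt_xi hΛ h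
    unfold uvSymbolFnXiD1 uvSymbolFnXiD2
    have hA := (hasDerivAt_uvWeightFnD1 Λ ω e).ofReal_comp.mul (hasDerivAt_resolventFnXi (c := c) hne)
    have hB := (hasDerivAt_uvWeightFn Λ ω e).ofReal_comp.mul (hasDerivAt_resolventFnXiD1 (c := c) hne)
    refine (hA.add hB).congr_deriv ?_
    ring
  · have hlt : e ^ 2 + ω ^ 2 < Λ ^ 2 / 4 := by linarith [not_lt.1 h, pow_pos hΛ 2]
    have hopen : ∀ᶠ t in nhds e, t ^ 2 + ω ^ 2 < Λ ^ 2 / 4 :=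
      (continuous_pow 2 |>.add continuous_const).continuousAt.eventually_lt continuousAt_const hlt
    have hev : uvSymbolFnXiD1 c Λ ω =ᶠ[nhds e] fun _ => (0 : ℂ) := by
      filter_upwards [hopen] with t ht
      obtain ⟨h0, h1, -⟩ := uvWeightFn_eq_zero_of_lt hΛ (e := ω) (ω := t) ht
      rw [uvSymbolFnXiD1, h0, h1, Complex.ofReal_zero, zero_mul, zero_mul, add_zero]
    have hD2 : uvSymbolFnXiD2 c Λ ω e = 0 := by
      obtain ⟨h0, h1, h2⟩ := uvWeightFn_eq_zero_of_lt hΛ (e := ω) (ω := e) hlt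
      rw [uvSymbolFnXiD2, h0, h1, h2, Complex.ofReal_zero]
      ring
    rw [hD2]
    exact (hasDerivAt_const e (0 : ℂ)).congr_of_eventuallyEq hev

/-- **`‖Ψ̂′(e)‖ ≤ (2B₁ + 1)·c/max(|ω|, Λ/2)²`** everywhere. [cite: BenfattoGiulianiMastropietro2006, (2.36aa)] -/
theorem norm_uvSymbolFnXiD1_le (hΛ : 0 < Λ) (hc : 0 ≤ c) {B₁ : ℝ} (hB₁ : ∀ x, |deriv salmhoferCutoff x| ≤ B₁) (e : ℝ) :
    ‖uvSymbolFnXiD1 c Λ ω e‖ ≤ (2 * B₁ + 1) * c / max |ω| (Λ / 2) ^ 2 := by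
  have hB10 : 0 ≤ B₁ := (abs_nonneg _).trans (hB₁ 0)
  have hm := uvEnv_pos hΛ ω
  set m := max |ω| (Λ / 2) with hmdef
  by_cases hlt : e ^ 2 + ω ^ 2 < Λ ^ 2 / 4
  · obtain ⟨h0, h1, -⟩ := uvWeightFn_eq_zero_of_lt hΛ hlt
    rw [uvSymbolFnXiD1, h0, h1, Complex.ofReal_zero]
    simp only [zero_mul, add_zero, norm_zero]
    positivity
  · have hden := max_le_norm_uvDen hΛ (e := e) (ω := ω) (by linarith [not_lt.1 hlt])
    rw [← hmdef] at hden
    have hR : ‖resolventFnXi c 0 ω e‖ ≤ c / m := by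
      rw [norm_resolventFnXi hc]; exact div_le_div_of_nonneg_left hc hm hden
    have hR1 : ‖resolventFnXiD1 c 0 ω e‖ ≤ c / m ^ 2 := by
      rw [norm_resolventFnXiD1 hc]; exact div_le_div_of_nonneg_left hc (by positivity) (pow_le_pow_left₀ hm.le hden 2)
    have hW : ‖(uvWeightFn Λ ω e : ℂ)‖ ≤ 1 := by
      rw [Complex.norm_real, Real.norm_eq_abs]; exact abs_uvWeightFn_le_one Λ ω e
    by_cases hgt : Λ ^ 2 < e ^ 2 + ω ^ 2
    · obtain ⟨h0, h1, -⟩ := uvWeightFn_eq_one_of_gt hΛ hgt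
      rw [uvSymbolFnXiD1, h0, h1, Complex.ofReal_zero, Complex.ofReal_one, zero_mul, zero_add, one_mul]
      refine hR1.trans ?_
      rw [div_le_div_iff_of_pos_right (by positivity)]
      nlinarith
    · have hmΛ : m ≤ Λ := by
        have := uvEnv_le_of_le hΛ (e := e) (ω := ω) (by linarith [not_lt.1 hgt])
        rwa [← hmdef] at this
      have hW1 : ‖(uvWeightFnD1 Λ ω e : ℂ)‖ ≤ 2 * B₁ / m := by
        rw [Complex.norm_real, Real.norm_eq_abs]
        exact (abs_uvWeightFnD1_le hB₁ hΛ ω e).trans (div_le_div_of_nonneg_left (by positivity) hm hmΛ)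
      rw [uvSymbolFnXiD1]
      calc _ ≤ ‖(uvWeightFnD1 Λ ω e : ℂ) * resolventFnXi c 0 ω e‖ + ‖(uvWeightFn Λ ω e : ℂ) * resolventFnXiD1 c 0 ω e‖ :=
            norm_add_le _ _
        _ ≤ 2 * B₁ / m * (c / m) + 1 * (c / m ^ 2) := by
            refine add_le_add ?_ ?_
            · rw [norm_mul]; exact mul_le_mul hW1 hR (norm_nonneg _) (by positivity)
            · rw [norm_mul]; exact mul_le_mul hW hR1 (norm_nonneg _) zero_le_one
        _ = (2 * B₁ + 1) * c / m ^ 2 := by field_simp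

/-- **`‖Ψ̂″(e)‖ ≤ (4B₂ + 6B₁ + 2)·c/max(|ω|, Λ/2)³`** everywhere. [cite: BenfattoGiulianiMastropietro2006, (2.36aa)] -/
theorem norm_uvSymbolFnXiD2_le (hΛ : 0 < Λ) (hc : 0 ≤ c) {B₁ B₂ : ℝ} (hB₁ : ∀ x, |deriv salmhoferCutoff x| ≤ B₁)
    (hB₂ : ∀ x, |deriv (deriv salmhoferCutoff) x| ≤ B₂) (e : ℝ) :
    ‖uvSymbolFnXiD2 c Λ ω e‖ ≤ (4 * B₂ + 6 * B₁ + 2) * c / max |ω| (Λ / 2) ^ 3 := by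
  have hB10 : 0 ≤ B₁ := (abs_nonneg _).trans (hB₁ 0)
  have hB20 : 0 ≤ B₂ := (abs_nonneg _).trans (hB₂ 0)
  have hm := uvEnv_pos hΛ ω
  set m := max |ω| (Λ / 2) with hmdef
  by_cases hlt : e ^ 2 + ω ^ 2 < Λ ^ 2 / 4
  · obtain ⟨h0, h1, h2⟩ := uvWeightFn_eq_zero_of_lt hΛ hlt
    rw [uvSymbolFnXiD2, h0, h1, h2, Complex.ofReal_zero]
    simp only [zero_mul, mul_zero, add_zero, norm_zero]
    positivity
  · have hden := max_le_norm_uvDen hΛ (e := e) (ω := ω) (by linarith [not_lt.1 hlt])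
    rw [← hmdef] at hden
    have hR : ‖resolventFnXi c 0 ω e‖ ≤ c / m := by
      rw [norm_resolventFnXi hc]; exact div_le_div_of_nonneg_left hc hm hden
    have hR1 : ‖resolventFnXiD1 c 0 ω e‖ ≤ c / m ^ 2 := by
      rw [norm_resolventFnXiD1 hc]; exact div_le_div_of_nonneg_left hc (by positivity) (pow_le_pow_left₀ hm.le hden 2)
    have hR2 : ‖resolventFnXiD2 c 0 ω e‖ ≤ 2 * c / m ^ 3 := by
      rw [norm_resolventFnXiD2 hc]
      exact div_le_div_of_nonneg_left (by positivity) (by positivity) (pow_le_pow_left₀ hm.le hden 3)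
    have hW : ‖(uvWeightFn Λ ω e : ℂ)‖ ≤ 1 := by
      rw [Complex.norm_real, Real.norm_eq_abs]; exact abs_uvWeightFn_le_one Λ ω e
    by_cases hgt : Λ ^ 2 < e ^ 2 + ω ^ 2
    · obtain ⟨h0, h1, h2⟩ := uvWeightFn_eq_one_of_gt hΛ hgt
      rw [uvSymbolFnXiD2, h0, h1, h2, Complex.ofReal_zero, Complex.ofReal_one]
      simp only [zero_mul, mul_zero, zero_add, one_mul]
      refine hR2.trans ?_
      rw [div_le_div_iff_of_pos_right (by positivity)]
      nlinarith
    · have hmΛ : m ≤ Λ := by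
        have := uvEnv_le_of_le hΛ (e := e) (ω := ω) (by linarith [not_lt.1 hgt])
        rwa [← hmdef] at this
      have hW1 : ‖(uvWeightFnD1 Λ ω e : ℂ)‖ ≤ 2 * B₁ / m := by
        rw [Complex.norm_real, Real.norm_eq_abs]
        exact (abs_uvWeightFnD1_le hB₁ hΛ ω e).trans (div_le_div_of_nonneg_left (by positivity) hm hmΛ)
      have hW2 : ‖(uvWeightFnD2 Λ ω e : ℂ)‖ ≤ (4 * B₂ + 2 * B₁) / m ^ 2 := by
        rw [Complex.norm_real, Real.norm_eq_abs]
        exact (abs_uvWeightFnD2_le hB₁ hB₂ hΛ ω e).trans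
          (div_le_div_of_nonneg_left (by positivity) (by positivity) (pow_le_pow_left₀ hm.le hmΛ 2))
      rw [uvSymbolFnXiD2]
      calc _ ≤ ‖(uvWeightFnD2 Λ ω e : ℂ) * resolventFnXi c 0 ω e‖ + ‖2 * ((uvWeightFnD1 Λ ω e : ℂ) * resolventFnXiD1 c 0 ω e)‖ +
            ‖(uvWeightFn Λ ω e : ℂ) * resolventFnXiD2 c 0 ω e‖ := norm_add₃_le
        _ ≤ (4 * B₂ + 2 * B₁) / m ^ 2 * (c / m) + 2 * (2 * B₁ / m * (c / m ^ 2)) + 1 * (2 * c / m ^ 3) := by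
            refine add_le_add (add_le_add ?_ ?_) ?_
            · rw [norm_mul]; exact mul_le_mul hW2 hR (norm_nonneg _) (by positivity)
            · rw [norm_mul, norm_mul, Complex.norm_ofNat]
              exact mul_le_mul_of_nonneg_left (mul_le_mul hW1 hR1 (norm_nonneg _) (by positivity)) (by norm_num)
            · rw [norm_mul]; exact mul_le_mul hW hR2 (norm_nonneg _) zero_le_one
        _ = (4 * B₂ + 6 * B₁ + 2) * c / m ^ 3 := by field_simp; ring

end Xi

/-! ### Composition with a `C²` path in the band variable (a lattice line of a dispersion relation) -/

/-- The symbol along a path `e(t)` in the band variable at fixed frequency: `G(t) = Ψ̂_ω(e(t))`. [cite: BenfattoGiulianiMastropietro2006, (2.36aa)] -/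
def uvPathFn (c Λ ω : ℝ) (e : ℝ → ℝ) (t : ℝ) : ℂ := uvSymbolFnXi c Λ ω (e t)

/-- `G′ = Ψ̂′(e)·e′`. [cite: BenfattoGiulianiMastropietro2006, (2.36aa)] -/
def uvPathFnD1 (c Λ ω : ℝ) (e e' : ℝ → ℝ) (t : ℝ) : ℂ := ((e' t : ℝ) : ℂ) * uvSymbolFnXiD1 c Λ ω (e t)

/-- `G″ = Ψ̂″(e)·e′² + Ψ̂′(e)·e″`. [cite: BenfattoGiulianiMastropietro2006, (2.36aa)] -/
def uvPathFnD2 (c Λ ω : ℝ) (e e' e'' : ℝ → ℝ) (t : ℝ) : ℂ :=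
  ((e' t : ℝ) : ℂ) * (((e' t : ℝ) : ℂ) * uvSymbolFnXiD2 c Λ ω (e t)) + ((e'' t : ℝ) : ℂ) * uvSymbolFnXiD1 c Λ ω (e t)

section Path

variable {c Λ ω : ℝ} {e e' e'' : ℝ → ℝ}

/-- **`G` is differentiable with derivative `G′`** along a differentiable path. [cite: BenfattoGiulianiMastropietro2006, (2.36aa)] -/
theorem hasDerivAt_uvPathFn (hΛ : 0 < Λ) {t : ℝ} (he : HasDerivAt e (e' t) t) :
    HasDerivAt (uvPathFn c Λ ω e) (uvPathFnD1 c Λ ω e e' t) t := by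
  unfold uvPathFn uvPathFnD1
  have h := (hasDerivAt_uvSymbolFnXi (c := c) (ω := ω) hΛ (e t)).scomp t he
  refine h.congr_deriv ?_
  rw [Complex.real_smul]

/-- **`G′` is differentiable with derivative `G″`** along a twice differentiable path. [cite: BenfattoGiulianiMastropietro2006, (2.36aa)] -/
theorem hasDerivAt_uvPathFnD1 (hΛ : 0 < Λ) {t : ℝ} (he : HasDerivAt e (e' t) t) (he' : HasDerivAt e' (e'' t) t) :
    HasDerivAt (uvPathFnD1 c Λ ω e e') (uvPathFnD2 c Λ ω e e' e'' t) t := by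
  unfold uvPathFnD1 uvPathFnD2
  have h1 := (hasDerivAt_uvSymbolFnXiD1 (c := c) (ω := ω) hΛ (e t)).scomp t he
  have h2 := he'.ofReal_comp
  refine (h2.mul h1).congr_deriv ?_
  rw [Complex.real_smul]
  simp only [Function.comp_apply]
  ring

/-- **`‖G″(t)‖ ≤ (D²(4B₂+6B₁+2)·(2/Λ) + D(2B₁+1))·c/max(|ω|, Λ/2)²`** for a path with `|e′|, |e″| ≤ D`.
[cite: BenfattoGiulianiMastropietro2006, (2.36aa)] -/
theorem norm_uvPathFnD2_le (hΛ : 0 < Λ) (hc : 0 ≤ c) {B₁ B₂ : ℝ} (hB₁ : ∀ x, |deriv salmhoferCutoff x| ≤ B₁)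
    (hB₂ : ∀ x, |deriv (deriv salmhoferCutoff) x| ≤ B₂) {D : ℝ} (hD : 0 ≤ D) {t : ℝ} (h1 : |e' t| ≤ D) (h2 : |e'' t| ≤ D) :
    ‖uvPathFnD2 c Λ ω e e' e'' t‖ ≤
      (D ^ 2 * (4 * B₂ + 6 * B₁ + 2) * (2 / Λ) + D * (2 * B₁ + 1)) * c / max |ω| (Λ / 2) ^ 2 := by
  have hB10 : 0 ≤ B₁ := (abs_nonneg _).trans (hB₁ 0)
  have hB20 : 0 ≤ B₂ := (abs_nonneg _).trans (hB₂ 0)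
  have hm := uvEnv_pos hΛ ω
  set m := max |ω| (Λ / 2) with hmdef
  have hmΛ : 1 / m ≤ 2 / Λ := by
    rw [div_le_div_iff₀ hm hΛ]; nlinarith [le_max_right |ω| (Λ / 2)]
  have hA := norm_uvSymbolFnXiD2_le (c := c) (ω := ω) hΛ hc hB₁ hB₂ (e t)
  have hB := norm_uvSymbolFnXiD1_le (c := c) (ω := ω) hΛ hc hB₁ (e t)
  rw [← hmdef] at hA hB
  have hA' : ‖uvSymbolFnXiD2 c Λ ω (e t)‖ ≤ (4 * B₂ + 6 * B₁ + 2) * (2 / Λ) * c / m ^ 2 := by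
    refine hA.trans ?_
    rw [show (4 * B₂ + 6 * B₁ + 2) * c / m ^ 3 = (4 * B₂ + 6 * B₁ + 2) * (1 / m) * c / m ^ 2 by field_simp]
    gcongr
  have he1 : ‖((e' t : ℝ) : ℂ)‖ ≤ D := by rw [Complex.norm_real, Real.norm_eq_abs]; exact h1
  have he2 : ‖((e'' t : ℝ) : ℂ)‖ ≤ D := by rw [Complex.norm_real, Real.norm_eq_abs]; exact h2
  rw [uvPathFnD2]
  calc _ ≤ ‖((e' t : ℝ) : ℂ) * (((e' t : ℝ) : ℂ) * uvSymbolFnXiD2 c Λ ω (e t))‖ + ‖((e'' t : ℝ) : ℂ) * uvSymbolFnXiD1 c Λ ω (e t)‖ :=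
        norm_add_le _ _
    _ ≤ D * (D * ((4 * B₂ + 6 * B₁ + 2) * (2 / Λ) * c / m ^ 2)) + D * ((2 * B₁ + 1) * c / m ^ 2) := by
        refine add_le_add ?_ ?_
        · rw [norm_mul, norm_mul]
          exact mul_le_mul he1 (mul_le_mul he1 hA' (norm_nonneg _) hD) (by positivity) hD
        · rw [norm_mul]
          exact mul_le_mul he2 hB (norm_nonneg _) hD
    _ = (D ^ 2 * (4 * B₂ + 6 * B₁ + 2) * (2 / Λ) + D * (2 * B₁ + 1)) * c / m ^ 2 := by ring

end Path

end Literature.MathematicalPhysics.QuantumLattice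

end
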